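import Summits.NavierStokesRegularity.NavierStokesRegularity.Theorems.CorkscrewDynamoCorkscrewProfileSharpRepresentative
import Summits.NavierStokesRegularity.NavierStokesRegularity.Theorems.CorkscrewDynamoCorkscrewProfileOfRssProfileExists
import Summits.NavierStokesRegularity.NavierStokesRegularity.Theorems.CorkscrewDynamoCorkscrewProfileRssWindow
import Summits.NavierStokesRegularity.NavierStokesRegularity.Theorems.RellichScarSymmetricScarExistsApexClassicalRepresentative
import HarnessLib

/-!
# Route CorkscrewDynamo · crux `CorkscrewProfile` (stmt-NavierStokesRegularity-11282) — the classical
# Pineau–Vicol representative of the data of `RssProfileExists` (tool stub T10 `stub_rssDataClassical`)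

Tool stub `stub_rssDataClassical` of line `registered` (skeleton v11, lead c5, wave 2): the data of the open
item `RssProfileExists` — a Type-I ancient mild Navier–Stokes field `u` with `C²` slice `U = u(−1)`, rotated
discretely self-similar for EVERY factor `c > 0` through the rotation `Rot(−2α log c)` about `e₃` (`Rot` pinned
on the standard basis) — have a CLASSICAL representative `V` on `(−∞, 0)` which is LITERALLY Pineau–Vicol's
ansatz field (1.7) of the profile `U` with angular speed `α`, `V(t, x) = pvAnsatz α U t x` for `t < 0`,
with `V(−1) = U`, in the Oseen gauge `IsTypeIAncientMild C₀ V` and with the same Type-I constant.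

* the pinned rotations are the rotations `rotZLIE` about `e₃` (`rot_apply_eq_rotZ_of_basis`), so the RSS law
  of `u` is `IsRotatedDSS μ (rotZLIE ((−2α) log μ)) u` for every `μ > 0`, and the dictionary
  `rss_eq_pvAnsatz` (the law at `μ = (−t)^{−1/2}`) gives `u(t) = pvAnsatz α U t` pointwise for `t < 0`;
* the sharp smooth representative `stub_sharpRepresentative` (KNSS 2009 §4) gives `V` in the Oseen gauge,
  `V(t) = u(t)` a.e. for every `t < 0`, same `C₀`;
* both `V(t)` (a smooth slice) and `pvAnsatz α U t` (`U ∈ C²`, `rotZ` continuous linear) are continuous,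
  so a.e. equality is equality (`Continuous.ae_eq_iff_eq`); at `t = −1` the ansatz is `U` (`pvAnsatz_neg_one`);
* `V` is classical on `(−∞, 0)` for one smooth pressure
  (`exists_isClassicalNSSolutionOn_Iio_of_isTypeIAncientMild`, Fabes–Jones–Rivière).

References: B. Pineau, V. Vicol, *On rotated backwards self-similar solutions of the incompressible 3D
Navier–Stokes equations*, arXiv:2607.09619 (2026), (1.7) p. 3 and Remark 1.3 [PineauVicol2026];
G. Koch, N. Nadirashvili, G. Seregin, V. Šverák, Acta Math. 203 (2009) = arXiv:0709.3599, §4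
[KochNadirashviliSereginSverak2009].
-/

noncomputable section

open MeasureTheory Set Function Filter Topology InnerProductSpace Metric
open Literature.Analysis.FluidPDE Literature.Analysis.FluidPDE.PineauVicol2026
open scoped RealInnerProductSpace Laplacian ContDiff NNReal ENNReal

namespace Summit.NavierStokesRegularity.NavierStokesRegularity.Theorems.CorkscrewProfile.Birth

set_option linter.dupNamespace false

open Summit.NavierStokesRegularity.NavierStokesRegularity.Theorems.SymmetricScarExists.LogtimeBernoulli
  (exists_isClassicalNSSolutionOn_Iio_of_isTypeIAncientMild)

/-- **The RSS law through pinned rotations is the RSS law through `rotZLIE` with angle rate `−2α`.**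
If `Rot` is pinned on the standard basis (so `Rot θ = rotZ θ`, `rot_apply_eq_rotZ_of_basis`) and `u` is rotated
`μ`-DSS through `Rot(−2α log μ)` for every `μ > 0`, then `u` is rotated `μ`-DSS through
`rotZLIE ((−2α) log μ)` for every `μ > 0`. [folklore] -/
theorem isRotatedDSS_rotZLIE_of_basis {α : ℝ}
    {Rot : ℝ → (EuclideanSpace ℝ (Fin 3) ≃ₗᵢ[ℝ] EuclideanSpace ℝ (Fin 3))}
    {u : ℝ → EuclideanSpace ℝ (Fin 3) → EuclideanSpace ℝ (Fin 3)}
    (hRot : ∀ θ : ℝ, Rot θ (EuclideanSpace.single 0 1) =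
        Real.cos θ • EuclideanSpace.single 0 1 + Real.sin θ • EuclideanSpace.single 1 1 ∧
      Rot θ (EuclideanSpace.single 1 1) =
        -(Real.sin θ • EuclideanSpace.single 0 1) + Real.cos θ • EuclideanSpace.single 1 1 ∧
      Rot θ (EuclideanSpace.single 2 1) = EuclideanSpace.single 2 1)
    (hrss : ∀ c : ℝ, 0 < c → IsRotatedDSS c (Rot (-(α * (2 * Real.log c)))) u) :
    ∀ μ : ℝ, 0 < μ → IsRotatedDSS μ (rotZLIE (-(2 * α) * Real.log μ)) u := by
  intro μ hμ t x
  have h := hrss μ hμ t x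
  rw [rot_apply_eq_rotZ_of_basis hRot, rot_symm_apply_eq_rotZ_of_basis hRot] at h
  have hang : -(2 * α) * Real.log μ = -(α * (2 * Real.log μ)) := by ring
  rw [rotZLIE_symm_apply, rotZLIE_apply, hang]
  exact h

/-- **The data of `RssProfileExists` are Pineau–Vicol's ansatz, pointwise on the past.** A field `u` with
`u(−1) = U` which is rotated `c`-DSS through the pinned rotation `Rot(−2α log c)` about `e₃` for every `c > 0`
satisfies `u(t, x) = pvAnsatz α U t x = (−t)^{−1/2} R(αs) U(R(−αs) x/√(−t))`, `s = −log(−t)`, for all `t < 0`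
(the RSS law at `c = (−t)^{−1/2}`; dictionary `rss_eq_pvAnsatz` with `β = −2α`). [cite: PineauVicol2026, (1.7) and Remark 1.3 (arXiv:2607.09619 p. 3)] -/
theorem rss_basis_eq_pvAnsatz {α : ℝ} {U : EuclideanSpace ℝ (Fin 3) → EuclideanSpace ℝ (Fin 3)}
    {Rot : ℝ → (EuclideanSpace ℝ (Fin 3) ≃ₗᵢ[ℝ] EuclideanSpace ℝ (Fin 3))}
    {u : ℝ → EuclideanSpace ℝ (Fin 3) → EuclideanSpace ℝ (Fin 3)}
    (hRot : ∀ θ : ℝ, Rot θ (EuclideanSpace.single 0 1) =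
        Real.cos θ • EuclideanSpace.single 0 1 + Real.sin θ • EuclideanSpace.single 1 1 ∧
      Rot θ (EuclideanSpace.single 1 1) =
        -(Real.sin θ • EuclideanSpace.single 0 1) + Real.cos θ • EuclideanSpace.single 1 1 ∧
      Rot θ (EuclideanSpace.single 2 1) = EuclideanSpace.single 2 1)
    (hu1 : u (-1) = U) (hrss : ∀ c : ℝ, 0 < c → IsRotatedDSS c (Rot (-(α * (2 * Real.log c)))) u) :
    ∀ t < 0, ∀ x, u t x = pvAnsatz α (fun y _ => U y) t x := by
  intro t ht x
  have h := rss_eq_pvAnsatz (isRotatedDSS_rotZLIE_of_basis hRot hrss) ht x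
  have hα : -(-(2 * α)) / 2 = α := by ring
  rw [hα, hu1] at h
  exact h

/-- **The ansatz slice of a `C²` (indeed continuous) profile is continuous**: for fixed `t`,
`x ↦ pvAnsatz α U t x = (√(−t))⁻¹ • R(θ) U(R(−θ) ((√(−t))⁻¹ • x))` is a composition of continuous maps
(`rotZ θ = rotZLIE θ` is a linear isometry). [folklore] -/
theorem continuous_pvAnsatz_slice {α : ℝ} {U : EuclideanSpace ℝ (Fin 3) → EuclideanSpace ℝ (Fin 3)}
    (hU : Continuous U) (t : ℝ) : Continuous fun x => pvAnsatz α (fun y _ => U y) t x := by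
  have h1 : Continuous fun w : EuclideanSpace ℝ (Fin 3) => rotZ (-(α * -Real.log (-t))) w :=
    (rotZLIE (-(α * -Real.log (-t)))).continuous
  have h2 : Continuous fun w : EuclideanSpace ℝ (Fin 3) => rotZ (α * -Real.log (-t)) w :=
    (rotZLIE (α * -Real.log (-t))).continuous
  simp only [pvAnsatz]
  exact (h2.comp (hU.comp (h1.comp (continuous_id.const_smul (Real.sqrt (-t))⁻¹)))).const_smul
    (Real.sqrt (-t))⁻¹

/-- **Tool stub T10 `stub_rssDataClassical` (registered signature) — the classical Pineau–Vicol representative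
of the data of `RssProfileExists`.** Let `u` be an ancient mild solution with measurable slices and Type-I decay
`HasTypeIDecay C₀ u`, with `C²` slice `U = u(−1)`, rotated `c`-DSS through the pinned rotation `Rot(−2α log c)`
about `e₃` for every `c > 0`. Then there are `V` and a pressure `q` with: `V` a Type-I ancient mild field in the
Oseen gauge with the same constant (`IsTypeIAncientMild C₀ V`, `HasTypeIDecay C₀ V`), `(V, q)` a classical
Navier–Stokes solution on `(−∞, 0)` (`ν = 1`, `f = 0`), `V(t, x) = pvAnsatz α U t x` for all `t < 0`, and
`V(−1) = U`.  Proof: `u = pvAnsatz α U` pointwise on the past (`rss_basis_eq_pvAnsatz`); the sharp smooth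
representative `V` of `stub_sharpRepresentative` (factor `2`) agrees with `u(t)` a.e. for each `t < 0`, and both
`V(t)` and the ansatz slice are continuous, so they are equal (`Continuous.ae_eq_iff_eq`); `V(−1) = U` by
`pvAnsatz_neg_one`; the pressure is `exists_isClassicalNSSolutionOn_Iio_of_isTypeIAncientMild`. [cite: PineauVicol2026, (1.7) and Remark 1.3 (arXiv:2607.09619 p. 3)] -/
theorem stub_rssDataClassical {α C₀ : ℝ} {U : EuclideanSpace ℝ (Fin 3) → EuclideanSpace ℝ (Fin 3)}
    {Rot : ℝ → (EuclideanSpace ℝ (Fin 3) ≃ₗᵢ[ℝ] EuclideanSpace ℝ (Fin 3))}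
    {u : ℝ → EuclideanSpace ℝ (Fin 3) → EuclideanSpace ℝ (Fin 3)}
    (hRot : ∀ θ : ℝ, Rot θ (EuclideanSpace.single 0 1) = Real.cos θ • EuclideanSpace.single 0 1 + Real.sin θ • EuclideanSpace.single 1 1 ∧
      Rot θ (EuclideanSpace.single 1 1) = -(Real.sin θ • EuclideanSpace.single 0 1) + Real.cos θ • EuclideanSpace.single 1 1 ∧
      Rot θ (EuclideanSpace.single 2 1) = EuclideanSpace.single 2 1)
    (hU2 : ContDiff ℝ 2 U) (hu1 : u (-1) = U)
    (hrss : ∀ c : ℝ, 0 < c → IsRotatedDSS c (Rot (-(α * (2 * Real.log c)))) u)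
    (hmild : IsAncientMildSolution 1 u) (hmeas : ∀ t < 0, MeasureTheory.AEStronglyMeasurable (u t) MeasureTheory.volume)
    (hC : HasTypeIDecay C₀ u) :
    ∃ (V : ℝ → EuclideanSpace ℝ (Fin 3) → EuclideanSpace ℝ (Fin 3)) (q : ℝ → EuclideanSpace ℝ (Fin 3) → ℝ),
      IsTypeIAncientMild C₀ V ∧ HasTypeIDecay C₀ V ∧ IsClassicalNSSolutionOn (Set.Iio 0) 1 0 V q ∧
      (∀ t < 0, ∀ x, V t x = pvAnsatz α (fun y _ => U y) t x) ∧ V (-1) = U := by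
  -- (2) the ansatz identity for `u` itself
  have hans : ∀ t < 0, ∀ x, u t x = pvAnsatz α (fun y _ => U y) t x := rss_basis_eq_pvAnsatz hRot hu1 hrss
  -- (3) the sharp smooth representative (factor `2`)
  obtain ⟨V, hVmild, -, hVdec, hae, -⟩ :=
    stub_sharpRepresentative 2 (Rot (-(α * (2 * Real.log 2)))) u C₀ two_pos hmild hmeas (hrss 2 two_pos) hC
  -- (4) `V = ansatz` pointwise on the past: both sides are continuous and a.e. equal
  have hV : ∀ t < 0, ∀ x, V t x = pvAnsatz α (fun y _ => U y) t x := by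
    intro t ht
    have h1 : V t =ᵐ[volume] fun x => pvAnsatz α (fun y _ => U y) t x :=
      (hae t ht).trans (Eventually.of_forall (hans t ht))
    have heq := (Continuous.ae_eq_iff_eq volume (hVmild.continuous_slice ht)
      (continuous_pvAnsatz_slice hU2.continuous t)).1 h1
    exact fun x => congrFun heq x
  have hV1 : V (-1) = U := by
    funext x
    rw [hV (-1) (by norm_num) x, pvAnsatz_neg_one]
  -- (5) a classical pressure on `(−∞, 0)`
  obtain ⟨q, hcl⟩ := exists_isClassicalNSSolutionOn_Iio_of_isTypeIAncientMild hVmild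
  exact ⟨V, q, hVmild, hVdec, hcl, hV, hV1⟩

end Summit.NavierStokesRegularity.NavierStokesRegularity.Theorems.CorkscrewProfile.Birth

end
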